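import Mathlib
import HarnessLib

/-!
# Uniqueness of the partial-fraction decomposition (linear factors, prescribed pole orders)

S. Lang, *Undergraduate Algebra* (1987), Ch. IV §4, Theorem 4.2 [Lang1987UndergraduateAlgebra]: every
rational function over a field `K` has an expression `R = h₁/p₁^{i₁} + ⋯ + hₙ/pₙ^{iₙ} + h` with distinct monic
irreducible `p_ν`, polynomials `h_ν`, `h`, `deg h_ν < deg p_ν^{i_ν}`, and "in such an expression the integers
`i_ν` and the polynomials `h_ν`, `h` are uniquely determined".  The uniqueness argument of loc. cit. (clear
denominators; `p₁^{i₁}` divides `h₁ ·` (a polynomial prime to `p₁`), hence divides `h₁`; `deg h₁ < deg p₁^{i₁}`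
forces `h₁ = 0`) is formalised here for LINEAR irreducibles `p_r = X − r`, `r` in a finite set `I ⊂ K` of
poles with prescribed orders `n r`, in the vanishing form that applications use:

* `eq_zero_of_num_eq_zero` : if the cleared numerator
  `num I n p p₀ = p₀ · ∏_{r∈I} (X − r)^{n r} + ∑_{r∈I} p r · ∏_{j∈I, j≠r} (X − j)^{n j}` vanishes and
  `deg (p r) < n r` for all `r ∈ I`, then `p₀ = 0` and every `p r = 0`;
* `eq_zero_of_eval_eq_zero` : the same conclusion from the numerical identity
  `p₀(t) + ∑_{r∈I} p r (t) / (t − r)^{n r} = 0` for all `t` in an INFINITE set avoiding `I`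
  (a polynomial with infinitely many roots is zero, loc. cit. IV §1);
* `eq_zero_of_eval_eq_zero_two` : the frequently used special case of double poles, `n ≡ 2`,
  numerators of degree `≤ 1`.

All statements are kernel-proved from Mathlib (`IsCoprime.dvd_of_dvd_mul_right`,
`Polynomial.eq_zero_of_dvd_of_degree_lt`, `Polynomial.eq_zero_of_infinite_isRoot`).

## Mathlib / tree

Mathlib's `Mathlib/Algebra/Polynomial/PartialFractions.lean` proves EXISTENCE
(`div_eq_quo_add_sum_rem_div`: `f / ∏ gᵢ = q + ∑ rᵢ / gᵢ` for pairwise coprime monic `gᵢ` over a domain) but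
no uniqueness statement; the tree has existence in the evaluated pole-order form for poles at `−i`,
`i ∈ ℕ` (`Literature.NumberTheory.Transcendental.PartialFractions`), expansions of specific functions
(`Literature.NumberTheory.DiophantineApproximation.DilogHermitePadePartialFractions`), and ONE special
uniqueness statement, `Literature.NumberTheory.Transcendental.pf_unique` (`BallRivoalLinearForms`: data
`c o p : ℚ` on poles `0, …, K−1` whose partial-fraction sum vanishes at all large naturals are zero, by
induction on `K`), which the general field / arbitrary finite pole set / polynomial-part form below does
not duplicate and could re-derive (`lean search 'PartialFractionUniqueness|pf_unique|eq_zero_of_num_eq_zero'`: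
only that hit and Mathlib's unrelated `IsLocalization`-`num` lemma `eq_zero_of_num_eq_zero`).

## Provenance

Staged by the pub-hodgecm formalisation cell (DAG-node prover #02 lineage) under the LEAN-IN-TREE rule; it
supersedes, generalised from `ℂ` and double poles to an arbitrary field and arbitrary pole orders and
re-sourced to print, the cell's standalone package file `HodgeCM/PerL34/PartialFractions.lean` (namespace
`HodgeCM.PerL34.PartialFractions`; its `pf_unique` is `eq_zero_of_eval_eq_zero_two` below with `K = ℂ`).

## Not here

Irreducible denominators of degree `> 1` and the existence half of Theorem 4.2 (Mathlib, see above).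
-/

noncomputable section

open Polynomial Finset

namespace Literature.Algebra.Polynomial

namespace PartialFractionUniqueness

variable {K : Type*} [Field K]

/-- The common denominator `den I n = ∏_{r ∈ I} (X − r)^{n r}`. [folklore] -/
def den (I : Finset K) (n : K → ℕ) : K[X] := ∏ r ∈ I, (X - C r) ^ n r

/-- `den` is monic. [folklore] -/
theorem den_monic (I : Finset K) (n : K → ℕ) : (den I n).Monic :=
  monic_prod_of_monic _ _ fun r _ => (monic_X_sub_C r).pow (n r)

/-- `den ≠ 0`. [folklore] -/
theorem den_ne_zero (I : Finset K) (n : K → ℕ) : den I n ≠ 0 := (den_monic I n).ne_zero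

/-- Evaluation of `den`. [folklore] -/
theorem eval_den (I : Finset K) (n : K → ℕ) (t : K) : (den I n).eval t = ∏ r ∈ I, (t - r) ^ n r := by
  simp [den, eval_prod]

variable [DecidableEq K]

/-- The cleared numerator `num I n p p₀ = p₀ · den + ∑_{r ∈ I} p r · ∏_{j ∈ I, j ≠ r} (X − j)^{n j}` of
`p₀ + ∑_{r ∈ I} p r / (X − r)^{n r}` (Lang's display `(*)` in the proof of IV Thm 4.3). [folklore] -/
def num (I : Finset K) (n : K → ℕ) (p : K → K[X]) (p₀ : K[X]) : K[X] :=
  p₀ * den I n + ∑ r ∈ I, p r * ∏ j ∈ I.erase r, (X - C j) ^ n j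

/-- Away from the poles, `num(t) = den(t) · (p₀(t) + ∑_r p r (t) / (t − r)^{n r})`. [folklore] -/
theorem eval_num (I : Finset K) (n : K → ℕ) (p : K → K[X]) (p₀ : K[X]) {t : K} (ht : t ∉ I) :
    (num I n p p₀).eval t = (den I n).eval t * (p₀.eval t + ∑ r ∈ I, (p r).eval t / (t - r) ^ n r) := by
  have hne : ∀ r ∈ I, (t - r) ^ n r ≠ 0 :=
    fun r hr => pow_ne_zero _ (sub_ne_zero.mpr (by rintro rfl; exact ht hr))
  have herase : ∀ r ∈ I, ∏ j ∈ I.erase r, (t - j) ^ n j = (∏ j ∈ I, (t - j) ^ n j) / (t - r) ^ n r := by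
    intro r hr
    rw [eq_div_iff (hne r hr), mul_comm, Finset.mul_prod_erase I (fun j => (t - j) ^ n j) hr]
  simp only [num, eval_add, eval_mul, eval_finsetSum, eval_prod, eval_pow, eval_sub, eval_X, eval_C,
    eval_den]
  rw [mul_add, Finset.mul_sum]
  congr 1
  · ring
  · refine Finset.sum_congr rfl fun r hr => ?_
    rw [herase r hr]
    field_simp

/-- If the numerical identity `p₀(t) + ∑_r p r (t) / (t − r)^{n r} = 0` holds on an infinite set avoiding
the poles, the cleared numerator is the zero polynomial (a polynomial with infinitely many roots vanishes).
[cite: Lang1987UndergraduateAlgebra, IV §1] -/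
theorem num_eq_zero_of_eval (I : Finset K) (n : K → ℕ) (p : K → K[X]) (p₀ : K[X]) {S : Set K}
    (hS : S.Infinite) (hSI : ∀ t ∈ S, t ∉ I)
    (h : ∀ t ∈ S, p₀.eval t + ∑ r ∈ I, (p r).eval t / (t - r) ^ n r = 0) : num I n p p₀ = 0 := by
  refine Polynomial.eq_zero_of_infinite_isRoot _ (hS.mono ?_)
  intro t ht
  simp only [Set.mem_setOf_eq, IsRoot.def, eval_num I n p p₀ (hSI t ht), h t ht, mul_zero]

/-- Once `num = 0`, each pole factor `(X − r)^{n r}` divides the corresponding term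
`p r · ∏_{j ≠ r} (X − j)^{n j}` (it divides every other summand). [folklore] -/
theorem dvd_term (I : Finset K) (n : K → ℕ) (p : K → K[X]) (p₀ : K[X]) (hP : num I n p p₀ = 0) {r : K}
    (hr : r ∈ I) : (X - C r) ^ n r ∣ p r * ∏ j ∈ I.erase r, (X - C j) ^ n j := by
  have hD : (X - C r) ^ n r ∣ den I n := Finset.dvd_prod_of_mem (fun j => (X - C j) ^ n j) hr
  have hother : ∀ k ∈ I.erase r, (X - C r) ^ n r ∣ p k * ∏ j ∈ I.erase k, (X - C j) ^ n j := by
    intro k hk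
    refine Dvd.dvd.mul_left (Finset.dvd_prod_of_mem (fun j => (X - C j) ^ n j) ?_) _
    exact Finset.mem_erase.mpr ⟨(Finset.mem_erase.mp hk).1.symm, hr⟩
  have hsplit : p r * ∏ j ∈ I.erase r, (X - C j) ^ n j =
      -(p₀ * den I n + ∑ k ∈ I.erase r, p k * ∏ j ∈ I.erase k, (X - C j) ^ n j) := by
    have := hP
    rw [num, ← Finset.add_sum_erase I _ hr] at this
    linear_combination this
  rw [hsplit]
  exact (Dvd.dvd.mul_left hD _ |>.add (Finset.dvd_sum hother)).neg_right

/-- `(X − r)^{n r}` is prime to `∏_{j ∈ I, j ≠ r} (X − j)^{n j}` (distinct linear factors). [folklore] -/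
theorem isCoprime_term (I : Finset K) (n : K → ℕ) {r : K} :
    IsCoprime ((X - C r) ^ n r) (∏ j ∈ I.erase r, (X - C j) ^ n j) := by
  refine IsCoprime.prod_right fun j hj => ?_
  have hne : r ≠ j := (Finset.mem_erase.mp hj).1.symm
  exact ((Polynomial.isCoprime_X_sub_C_of_isUnit_sub (sub_ne_zero.mpr hne).isUnit).pow)

/-- **Uniqueness of the partial-fraction decomposition** (Lang, *Undergraduate Algebra*, IV Thm 4.2,
uniqueness part, for linear irreducibles with prescribed exponents): if
`p₀ · ∏_{r∈I} (X − r)^{n r} + ∑_{r∈I} p r · ∏_{j≠r} (X − j)^{n j} = 0` with `deg (p r) < n r` for every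
`r ∈ I`, then `p₀ = 0` and all `p r = 0` (`r ∈ I`). [cite: Lang1987UndergraduateAlgebra, IV Thm 4.2] -/
theorem eq_zero_of_num_eq_zero (I : Finset K) (n : K → ℕ) (p : K → K[X])
    (hp : ∀ r ∈ I, (p r).degree < n r) (p₀ : K[X]) (hP : num I n p p₀ = 0) :
    p₀ = 0 ∧ ∀ r ∈ I, p r = 0 := by
  have hpr : ∀ r ∈ I, p r = 0 := by
    intro r hr
    have hdvd : (X - C r) ^ n r ∣ p r :=
      (isCoprime_term I n).dvd_of_dvd_mul_right (dvd_term I n p p₀ hP hr)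
    refine Polynomial.eq_zero_of_dvd_of_degree_lt hdvd ?_
    rw [degree_pow, degree_X_sub_C, nsmul_eq_mul, mul_one]
    exact hp r hr
  refine ⟨?_, hpr⟩
  have h0 : p₀ * den I n = 0 := by
    have := hP
    rw [num, Finset.sum_eq_zero (fun r hr => by rw [hpr r hr, zero_mul]), add_zero] at this
    exact this
  exact (mul_eq_zero.mp h0).resolve_right (den_ne_zero I n)

/-- **Uniqueness of partial fractions, numerical form**: if `p₀(t) + ∑_{r∈I} p r (t) / (t − r)^{n r} = 0`
for every `t` in an infinite subset of `K` avoiding `I`, and `deg (p r) < n r` on `I`, then `p₀ = 0` and all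
`p r = 0`. [cite: Lang1987UndergraduateAlgebra, IV Thm 4.2] -/
theorem eq_zero_of_eval_eq_zero (I : Finset K) (n : K → ℕ) (p : K → K[X])
    (hp : ∀ r ∈ I, (p r).degree < n r) (p₀ : K[X]) {S : Set K} (hS : S.Infinite)
    (hSI : ∀ t ∈ S, t ∉ I) (h : ∀ t ∈ S, p₀.eval t + ∑ r ∈ I, (p r).eval t / (t - r) ^ n r = 0) :
    p₀ = 0 ∧ ∀ r ∈ I, p r = 0 :=
  eq_zero_of_num_eq_zero I n p hp p₀ (num_eq_zero_of_eval I n p p₀ hS hSI h)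

/-- **Double poles**: if `p₀(t) + ∑_{r∈I} p r (t) / (t − r)² = 0` on an infinite set avoiding `I` with
`deg (p r) ≤ 1`, then `p₀ = 0` and all `p r = 0`. [cite: Lang1987UndergraduateAlgebra, IV Thm 4.2] -/
theorem eq_zero_of_eval_eq_zero_two (I : Finset K) (p : K → K[X]) (hp : ∀ r ∈ I, (p r).natDegree ≤ 1)
    (p₀ : K[X]) {S : Set K} (hS : S.Infinite) (hSI : ∀ t ∈ S, t ∉ I)
    (h : ∀ t ∈ S, p₀.eval t + ∑ r ∈ I, (p r).eval t / (t - r) ^ 2 = 0) :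
    p₀ = 0 ∧ ∀ r ∈ I, p r = 0 := by
  refine eq_zero_of_eval_eq_zero I (fun _ => 2) p (fun r hr => ?_) p₀ hS hSI h
  calc (p r).degree ≤ (1 : ℕ) := degree_le_of_natDegree_le (hp r hr)
    _ < ((2 : ℕ) : WithBot ℕ) := by exact_mod_cast one_lt_two

end PartialFractionUniqueness

end Literature.Algebra.Polynomial

end
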